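import Mathlib
import Summits.ValiantsHypothesis.ValiantsHypothesis.Theorems.ValuativeGCTValuativeFlipHilbertLowerBound

/-!
# Tools for the four-row Hilbert-function lower bound (line `four-row-count`, part 1 of 2)

Crux `ValuativeGCT.ValuativeFlip` (stmt-ValiantsHypothesis-12624), line
`Cruxes/ValuativeFlip/Lines/four_row_count.lean`, registered stub `stub_fourRowHilbertLowerBound`
(per side of the four-row census; proved in part 2,
`Theorems/ValuativeGCTValuativeFlipFourRowHilbertLowerBound.lean`).  This file carries the two
ingredients that the landed B3 (`stub_hilbertLowerBound`,
`Theorems/ValuativeGCTValuativeFlipHilbertLowerBound.lean`) does not have: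

* BASE CHANGE (`frh_genericOrbitMap_linSubst`, `frh_finrank_map_linSubst`):
  `genericOrbitMap (g · f) m = θ_g ∘ genericOrbitMap f m` for the algebra endomorphism
  `θ_g : Y ↦ Y · g` (`X (a, b) ↦ ∑ l, g l b • X (a, l)`) of `ℂ[Mat_σ]`, injective for invertible `g`;
  hence the image of ANY space of coordinate functions under the generic orbit map has the same
  dimension for `f` and for `g · f` (the base point of an initial-form argument can be moved to `1`);
* `K`-SUPPORTED COEFFICIENT FUNCTIONALS: for a predicate `κ` (kept variables `K`) and the
  restriction `ρ` (`x_i ↦ x_i` on `K`, `0` off `K`), the `K`-supported rows of the tangent matrix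
  `M[d, (a,b)] = coeff_d (x_a ∂_b h)` have row rank `≥ dim span{x_a · ρ(∂_b h) : a ∈ K}`
  (`frh_rowRank`: row rank = column rank, columns = coefficient vectors of `ρ(x_a ∂_b h)`), and the
  counting step `frh_count`: degree-`δ` monomials in `N + 1` translated `K`-supported functionals
  with independent lowest-degree forms give `C(δ + N, N)` independent elements of the degree-`δ`,
  `K`-supported orbit-image piece.
[Mulmuley–Sohoni 2001 §4; BLMW 2011 §5.2; folklore]
-/

-- `Summit.ValiantsHypothesis.ValiantsHypothesis.…` is the tree's mandated single-conjunct layout (Sub = Summit).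
set_option linter.dupNamespace false

namespace Summit.ValiantsHypothesis.ValiantsHypothesis.Theorems.ValuativeFlip

open MvPolynomial
open scoped BigOperators Matrix
open Literature.NumberTheory.DiophantineGeometry
open Literature.Computability.AlgebraicComplexity

noncomputable section

/-- `hlbτ⟦σ⟧`: the translation `A ↦ 1 + A` on `ℂ[Mat_σ]` (as in B3). -/
local notation3 "hlbτ⟦" s "⟧" =>
  (MvPolynomial.aeval (R := ℂ) fun p : s × s => X p + C (if p.1 = p.2 then (1 : ℂ) else 0))

/-- `hlbM⟦σ, f, m⟧`: the tangent matrix `M[d, (a,b)] = coeff_d (x_a ∂_b f)` (as in B3). -/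
local notation3 "hlbM⟦" s ", " f ", " m "⟧" =>
  (Matrix.of fun (d : DegIdx s m) (p : s × s) => coeff d.1 (X p.1 * pderiv p.2 f))

/-! ### Base change `Y ↦ Y · g` on the generic orbit map -/

section BaseChange

variable {σ : Type*} [Fintype σ]

/-- The base change `θ_g : X (a, b) ↦ ∑ l, g l b • X (a, l)` sends the generic matrix `Y` to
`Y * C(g)`. [folklore] -/
theorem frh_mvPolynomialX_map_baseChange (g : Matrix σ σ ℂ) :
    (Matrix.mvPolynomialX σ σ ℂ).map
        (aeval (R := ℂ) fun p : σ × σ => ∑ l, g l p.2 • (X (p.1, l) : MvPolynomial (σ × σ) ℂ)).toRingHom =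
      Matrix.mvPolynomialX σ σ ℂ * g.map (C : ℂ → MvPolynomial (σ × σ) ℂ) := by
  refine Matrix.ext fun a b => ?_
  rw [Matrix.map_apply, Matrix.mvPolynomialX_apply, Matrix.mul_apply]
  show (aeval (R := ℂ) fun p : σ × σ => ∑ l, g l p.2 • (X (p.1, l) : MvPolynomial (σ × σ) ℂ)) (X (a, b)) = _
  rw [aeval_X]
  refine Finset.sum_congr rfl fun l _ => ?_
  rw [Matrix.mvPolynomialX_apply, Matrix.map_apply, smul_eq_C_mul, mul_comm]

/-- Composition of base changes: `θ_{g'} ∘ θ_g = θ_{g' g}`. [folklore] -/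
theorem frh_baseChange_comp (g g' : Matrix σ σ ℂ) :
    (aeval (R := ℂ) fun p : σ × σ => ∑ l, g' l p.2 • (X (p.1, l) : MvPolynomial (σ × σ) ℂ)).comp
        (aeval (R := ℂ) fun p : σ × σ => ∑ l, g l p.2 • (X (p.1, l) : MvPolynomial (σ × σ) ℂ)) =
      aeval fun p : σ × σ => ∑ l, (g' * g) l p.2 • (X (p.1, l) : MvPolynomial (σ × σ) ℂ) := by
  apply MvPolynomial.algHom_ext
  intro p
  rw [AlgHom.comp_apply, aeval_X, aeval_X, map_sum]
  simp only [map_smul, aeval_X, Finset.smul_sum, smul_smul, Matrix.mul_apply, Finset.sum_smul]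
  rw [Finset.sum_comm]
  exact Finset.sum_congr rfl fun l' _ => Finset.sum_congr rfl fun l _ => by rw [mul_comm]

variable [DecidableEq σ] in
/-- The base change by the identity matrix is the identity. [folklore] -/
theorem frh_baseChange_one :
    (aeval (R := ℂ) fun p : σ × σ => ∑ l, (1 : Matrix σ σ ℂ) l p.2 • (X (p.1, l) : MvPolynomial (σ × σ) ℂ)) =
      AlgHom.id ℂ (MvPolynomial (σ × σ) ℂ) := by
  apply MvPolynomial.algHom_ext
  intro p
  rw [aeval_X, AlgHom.id_apply,
    Finset.sum_eq_single p.2 (fun l _ hl => by rw [Matrix.one_apply_ne hl, zero_smul])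
      (fun h => absurd (Finset.mem_univ _) h),
    Matrix.one_apply_eq, one_smul]

variable [DecidableEq σ] in
/-- The base change by an invertible matrix is injective. [folklore] -/
theorem frh_baseChange_injective (g : GL σ ℂ) :
    Function.Injective
      (aeval (R := ℂ) fun p : σ × σ => ∑ l, (g : Matrix σ σ ℂ) l p.2 • (X (p.1, l) : MvPolynomial (σ × σ) ℂ)) := by
  have h := frh_baseChange_comp ((g : Matrix σ σ ℂ)) (((g⁻¹ : GL σ ℂ) : Matrix σ σ ℂ))
  rw [show ((g⁻¹ : GL σ ℂ) : Matrix σ σ ℂ) * (g : Matrix σ σ ℂ) = 1 from Units.inv_mul g,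
    frh_baseChange_one] at h
  intro x y hxy
  have h2 := congrArg
    (aeval (R := ℂ) fun p : σ × σ => ∑ l, ((g⁻¹ : GL σ ℂ) : Matrix σ σ ℂ) l p.2 • (X (p.1, l) : MvPolynomial (σ × σ) ℂ)) hxy
  rwa [← AlgHom.comp_apply, ← AlgHom.comp_apply, h] at h2

variable [LinearOrder σ]

/-- **Base change of the generic orbit map.** `genericOrbitMap (g · f) m = θ_g ∘ genericOrbitMap f m`:
the coefficients of `(Y · (g · f))` are those of `((Y g) · f)`. [folklore] -/
theorem frh_genericOrbitMap_linSubst (f : MvPolynomial σ ℂ) (m : ℕ) (g : Matrix σ σ ℂ) :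
    genericOrbitMap (linSubst σ ℂ g f) m =
      (aeval (R := ℂ) fun p : σ × σ => ∑ l, g l p.2 • (X (p.1, l) : MvPolynomial (σ × σ) ℂ)).comp
        (genericOrbitMap f m) := by
  apply MvPolynomial.algHom_ext
  intro d
  set θ := (aeval (R := ℂ) fun p : σ × σ => ∑ l, g l p.2 • (X (p.1, l) : MvPolynomial (σ × σ) ℂ)) with hθ
  have hC : θ.toRingHom.comp (C : ℂ →+* MvPolynomial (σ × σ) ℂ) = C :=
    RingHom.ext fun a => θ.commutes a
  rw [AlgHom.comp_apply, show genericOrbitMap (linSubst σ ℂ g f) m (X d) = _ from aeval_X _ _,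
    show genericOrbitMap f m (X d) = _ from aeval_X _ _, map_linSubst C g f, ← AlgHom.comp_apply,
    ← linSubst_mul,
    show θ (coeff d.1 (linSubst σ (MvPolynomial (σ × σ) ℂ) (Matrix.mvPolynomialX σ σ ℂ)
      (map (C : ℂ →+* MvPolynomial (σ × σ) ℂ) f))) = coeff d.1 (map θ.toRingHom
        (linSubst σ (MvPolynomial (σ × σ) ℂ) (Matrix.mvPolynomialX σ σ ℂ)
          (map (C : ℂ →+* MvPolynomial (σ × σ) ℂ) f))) from (coeff_map _ _ _).symm,
    map_linSubst, map_map, hC, frh_mvPolynomialX_map_baseChange]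

end BaseChange

/-- **The dimension of an orbit-image piece does not depend on the base point** (registered
sub-goal): for invertible `g` and any space `S` of coordinate functions,
`dim genericOrbitMap_{g·f}(S) = dim genericOrbitMap_f(S)`. [folklore] -/
theorem frh_finrank_map_linSubst {σ : Type*} [Fintype σ] [LinearOrder σ] (f : MvPolynomial σ ℂ) (m : ℕ) (g : GL σ ℂ) (S : Submodule ℂ (MvPolynomial (DegIdx σ m) ℂ)) : Module.finrank ℂ ↥(S.map (genericOrbitMap (linSubst σ ℂ (g : Matrix σ σ ℂ) f) m).toLinearMap) = Module.finrank ℂ ↥(S.map (genericOrbitMap f m).toLinearMap) := by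
  rw [frh_genericOrbitMap_linSubst, AlgHom.comp_toLinearMap, Submodule.map_comp]
  exact (Submodule.equivMapOfInjective _ (frh_baseChange_injective g) _).finrank_eq.symm

/-! ### Initial forms with `K`-supported coefficient functionals -/

section Core

variable {σ : Type*} [Fintype σ]

/-- The restriction `ρ` (`x_i ↦ x_i` on `K`, `0` off `K`) keeps a monomial supported on `K` and
kills every other monomial. [folklore] -/
theorem frh_restrict_monomial (κ : σ → Prop) [DecidablePred κ] (d : σ →₀ ℕ) (c : ℂ) :
    aeval (fun i => if κ i then (X i : MvPolynomial σ ℂ) else 0) (monomial d c) =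
      if ∀ i, ¬ κ i → d i = 0 then monomial d c else 0 := by
  rw [aeval_monomial, MvPolynomial.algebraMap_eq]
  split_ifs with hd
  · rw [monomial_eq]
    congr 1
    refine Finset.prod_congr rfl fun i hi => ?_
    have hκ : κ i := by
      by_contra hκ
      exact (Finsupp.mem_support_iff.mp hi) (hd i hκ)
    simp only [if_pos hκ]
  · push Not at hd
    obtain ⟨i, hκ, hdi⟩ := hd
    rw [Finsupp.prod, Finset.prod_eq_zero (Finsupp.mem_support_iff.mpr hdi)
      (by rw [if_neg hκ, zero_pow hdi]), mul_zero]

variable [LinearOrder σ]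

/-- The restriction of a form of degree `m`, expanded in the degree-`m` monomials. [folklore] -/
theorem frh_restrict_eq_sum (κ : σ → Prop) [DecidablePred κ] {T : MvPolynomial σ ℂ} {m : ℕ}
    (hT : T.IsHomogeneous m) :
    aeval (fun i => if κ i then (X i : MvPolynomial σ ℂ) else 0) T =
      ∑ d : {d : DegIdx σ m // ∀ i, ¬ κ i → d.1 i = 0},
        coeff d.1.1 T • (monomial d.1.1 (1 : ℂ) : MvPolynomial σ ℂ) := by
  classical
  conv_lhs => rw [← sum_coeff_smul_monomial_eq hT, map_sum]
  simp only [map_smul, frh_restrict_monomial, smul_ite, smul_zero]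
  rw [← Finset.sum_filter]
  exact (Finset.sum_subtype _ (fun d => by simp) fun d : DegIdx σ m =>
    coeff d.1 T • (monomial d.1 (1 : ℂ) : MvPolynomial σ ℂ))

/-- **Rank transfer, `K`-rows.** The restricted tangent span `span{x_a · ρ(∂_b h) : a ∈ K}` has
dimension at most the row rank of the `K`-supported rows of the tangent matrix (in fact equal:
row rank = column rank, and the columns are the coefficient vectors of `ρ(x_a ∂_b h)`). [folklore] -/
theorem frh_rowRank (κ : σ → Prop) [DecidablePred κ] {h : MvPolynomial σ ℂ} {m : ℕ}
    (hh : h.IsHomogeneous m) :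
    Module.finrank ℂ ↥(Submodule.span ℂ (Set.range fun ab : {a // κ a} × σ =>
        (X ab.1.1 : MvPolynomial σ ℂ) *
          aeval (fun i => if κ i then (X i : MvPolynomial σ ℂ) else 0) (pderiv ab.2 h))) ≤
      Module.finrank ℂ ↥(Submodule.span ℂ (Set.range
        ((hlbM⟦σ, h, m⟧).submatrix
          (Subtype.val : {d : DegIdx σ m // ∀ i, ¬ κ i → d.1 i = 0} → DegIdx σ m) id).row)) := by
  classical
  have hhom : ∀ ab : σ × σ, (X ab.1 * pderiv ab.2 h).IsHomogeneous m := fun ab => by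
    obtain _ | m := m
    · rw [← totalDegree_zero_iff_isHomogeneous, totalDegree_eq_zero_iff_eq_C] at hh
      rw [hh, pderiv_C, mul_zero]
      exact isHomogeneous_zero _ _ _
    · simpa [add_comm] using (isHomogeneous_X ℂ ab.1).mul (hh.pderiv (i := ab.2))
  set ι := {d : DegIdx σ m // ∀ i, ¬ κ i → d.1 i = 0}
  set MK := (hlbM⟦σ, h, m⟧).submatrix (Subtype.val : ι → DegIdx σ m) id with hMK
  set ρ := (aeval (R := ℂ) fun i => if κ i then (X i : MvPolynomial σ ℂ) else 0) with hρ
  set φ := Fintype.linearCombination ℂ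
    (fun d : ι => (monomial d.1.1 (1 : ℂ) : MvPolynomial σ ℂ)) with hφ
  have hinj : Function.Injective φ := by
    rw [hφ, ← linearIndependent_iff_injective_fintypeLinearCombination]
    have hb := (basisMonomials σ ℂ).linearIndependent
    rw [coe_basisMonomials] at hb
    exact hb.comp (fun d : ι => d.1.1) (Subtype.val_injective.comp Subtype.val_injective)
  have hcol : (fun ab : σ × σ => ρ (X ab.1 * pderiv ab.2 h)) = φ ∘ MK.col := by
    funext ab
    rw [Function.comp_apply, hφ, Fintype.linearCombination_apply, hρ, frh_restrict_eq_sum κ (hhom ab)]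
    rfl
  -- the hypothesis span sits inside `span{ρ(x_a ∂_b h)}`
  have hle : Submodule.span ℂ (Set.range fun ab : {a // κ a} × σ =>
      (X ab.1.1 : MvPolynomial σ ℂ) * ρ (pderiv ab.2 h)) ≤
      Submodule.span ℂ (Set.range fun ab : σ × σ => ρ (X ab.1 * pderiv ab.2 h)) := by
    refine Submodule.span_le.mpr ?_
    rintro _ ⟨ab, rfl⟩
    refine Submodule.subset_span ⟨(ab.1.1, ab.2), ?_⟩
    simp only [hρ, map_mul, aeval_X, if_pos ab.1.2]
  haveI : FiniteDimensional ℂ ↥(Submodule.span ℂ (Set.range fun ab : σ × σ =>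
      ρ (X ab.1 * pderiv ab.2 h))) :=
    FiniteDimensional.span_of_finite ℂ (Set.finite_range _)
  refine (Submodule.finrank_mono hle).trans (le_of_eq ?_)
  rw [hcol, Set.range_comp, ← Submodule.map_span, ← Matrix.rank_eq_finrank_span_row,
    Matrix.rank_eq_finrank_span_cols]
  exact (Submodule.equivMapOfInjective φ hinj _).finrank_eq.symm

/-- **Counting step** (shared by both cases of `frh_core`): `N + 1` coordinate combinations
`∑_d avec k d • X_d` supported on `D_K` whose translated orbit images have lowest-degree forms
`lead k` in degree `pdeg k`, such that the monomials of degree `δ` in the `lead k` are linearly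
independent, give `C(δ + N, N)` independent elements of the degree-`δ`, `D_K`-supported orbit-image
piece. [folklore] -/
theorem frh_count (h : MvPolynomial σ ℂ) (m : ℕ) (P : DegIdx σ m → Prop) (N δ : ℕ)
    (avec : Fin (N + 1) → DegIdx σ m → ℂ) (havec : ∀ k d, ¬ P d → avec k d = 0)
    (pdeg : Fin (N + 1) → ℕ) (lead : Fin (N + 1) → MvPolynomial (σ × σ) ℂ)
    (hwk : ∀ k, (∀ j < pdeg k, homogeneousComponent j (hlbτ⟦σ⟧ (genericOrbitMap h m
        (∑ d, avec k d • (X d : MvPolynomial (DegIdx σ m) ℂ)))) = 0) ∧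
      homogeneousComponent (pdeg k) (hlbτ⟦σ⟧ (genericOrbitMap h m
        (∑ d, avec k d • (X d : MvPolynomial (DegIdx σ m) ℂ)))) = lead k)
    (hLI : LinearIndependent ℂ fun e : DegIdx (Fin (N + 1)) δ => ∏ k, lead k ^ e.1 k) :
    Nat.choose (δ + N) N ≤ Module.finrank ℂ ↥((MvPolynomial.homogeneousSubmodule (DegIdx σ m) ℂ δ ⊓
        Subalgebra.toSubmodule (MvPolynomial.supported ℂ {d : DegIdx σ m | P d})).map
          (genericOrbitMap h m).toLinearMap) := by
  classical
  set lin : (DegIdx σ m → ℂ) → MvPolynomial (DegIdx σ m) ℂ :=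
    fun c => ∑ d, c d • (X d : MvPolynomial (DegIdx σ m) ℂ) with hlin
  set G : MvPolynomial (DegIdx σ m) ℂ →ₐ[ℂ] MvPolynomial (σ × σ) ℂ :=
    (hlbτ⟦σ⟧).comp (genericOrbitMap h m) with hG
  set w : Fin (N + 1) → MvPolynomial (σ × σ) ℂ := fun k => G (lin (avec k)) with hw
  have hwk' : ∀ k, (∀ j < pdeg k, homogeneousComponent j (w k) = 0) ∧
      homogeneousComponent (pdeg k) (w k) = lead k := hwk
  set Q : DegIdx (Fin (N + 1)) δ → MvPolynomial (DegIdx σ m) ℂ :=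
    fun e => ∏ k, lin (avec k) ^ e.1 k with hQ
  set n : DegIdx (Fin (N + 1)) δ → ℕ := fun e => ∑ k, e.1 k * pdeg k
  have hP : ∀ e, (∀ j < n e, homogeneousComponent j (G (Q e)) = 0) ∧
      homogeneousComponent (n e) (G (Q e)) = ∏ k, lead k ^ e.1 k := by
    intro e
    have hGQ : G (Q e) = ∏ k, w k ^ (e.1 k) := by simp only [hQ, map_prod, map_pow, hw]
    have h := hlbOrd_prod Finset.univ (fun k => e.1 k * pdeg k) (fun k => w k ^ e.1 k)
      fun k _ => (hlbOrd_pow (hwk' k).1 (e.1 k)).1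
    rw [hGQ]
    exact ⟨h.1, h.2.trans (Finset.prod_congr rfl fun k _ =>
      (hlbOrd_pow (hwk' k).1 (e.1 k)).2.trans (congrArg (· ^ e.1 k) (hwk' k).2))⟩
  have hPLI : LinearIndependent ℂ (fun e => G (Q e)) :=
    hlb_linearIndependent_of_initialForms _ _ n hLI (fun e => (hP e).1) (fun e => (hP e).2)
  have hlinmem : ∀ k, lin (avec k) ∈ MvPolynomial.supported ℂ {d : DegIdx σ m | P d} := fun k => by
    refine Subalgebra.sum_mem _ fun d _ => ?_
    by_cases hd : P d
    · exact Subalgebra.smul_mem _ (X_mem_supported.mpr hd) _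
    · rw [havec k d hd, zero_smul]
      exact Subalgebra.zero_mem _
  have hQmem : ∀ e, Q e ∈ MvPolynomial.homogeneousSubmodule (DegIdx σ m) ℂ δ ⊓
      Subalgebra.toSubmodule (MvPolynomial.supported ℂ {d : DegIdx σ m | P d}) := fun e => by
    refine ⟨?_, ?_⟩
    · rw [SetLike.mem_coe, mem_homogeneousSubmodule, hQ]
      have h := IsHomogeneous.prod Finset.univ (fun k => lin (avec k) ^ e.1 k) (fun k => 1 * e.1 k)
        fun k _ => IsHomogeneous.pow ((mem_homogeneousSubmodule 1 _).mp (Submodule.sum_mem _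
          fun d _ => Submodule.smul_mem _ _ ((mem_homogeneousSubmodule 1 _).mpr
            (isHomogeneous_X ℂ d)))) (e.1 k)
      simp only [one_mul] at h
      rwa [← Finsupp.degree_eq_sum, mem_degMonomials_iff.mp e.2] at h
    · change Q e ∈ MvPolynomial.supported ℂ {d : DegIdx σ m | P d}
      exact Subalgebra.prod_mem _ fun k _ => Subalgebra.pow_mem _ (hlinmem k) _
  have := finite_homogeneousSubmodule (DegIdx σ m) ℂ δ
  haveI : Module.Finite ℂ ↥(MvPolynomial.homogeneousSubmodule (DegIdx σ m) ℂ δ ⊓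
      Subalgebra.toSubmodule (MvPolynomial.supported ℂ {d : DegIdx σ m | P d})) :=
    Module.Finite.of_injective (Submodule.inclusion inf_le_left) (Submodule.inclusion_injective _)
  have hfam : LinearIndependent ℂ (fun e : DegIdx (Fin (N + 1)) δ =>
      (⟨genericOrbitMap h m (Q e), Submodule.mem_map_of_mem (hQmem e)⟩ :
        ↥((MvPolynomial.homogeneousSubmodule (DegIdx σ m) ℂ δ ⊓
          Subalgebra.toSubmodule (MvPolynomial.supported ℂ {d : DegIdx σ m | P d})).map
            (genericOrbitMap h m).toLinearMap))) :=
    LinearIndependent.of_comp (Submodule.subtype _)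
      (LinearIndependent.of_comp (hlbτ⟦σ⟧).toLinearMap hPLI)
  have hcard := hfam.fintype_card_le_finrank
  rwa [Fintype.card_coe, degMonomials, Finset.card_finsuppAntidiag_nat_eq_choose, Finset.card_univ,
    Fintype.card_fin, show N + 1 + δ - 1 = δ + N by omega, Nat.choose_symm_add] at hcard

end Core

end

end Summit.ValiantsHypothesis.ValiantsHypothesis.Theorems.ValuativeFlip
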